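import Summits.QuantumFields.YangMills.Theorems.BalabanUVNodesN06StepL2AtPinsPhysR

/-!
# BalabanUVNodes ∕ N06 ([B9], `Dag.B9_main`) — THE L² STEP `hstepL2` AT PRINT'S CLASS, LITERALLY IN dag-n06-d's STEP-3 FORM (α): `…N06StepL2AtPinsPhysR` at
# `R₁ := regYP335`, `R₂ := regYP336` with the premises SPELLED `(bg9YP (M_N(ℂ)) SU(N) x).Reg335 c α₀ U` (drop-in face for ED.39's call of `stepL2_of_letter_schemas_residual`)

Track A of `YM-PLAN.md` (cell `pub-ymgap`, HUMAN RULING D-0062), node **N06** = [Balaban1985BackgroundPropagators] Thms 3.1–3.15; seat `pub-ymgap-dag-n06-w8` (g3), 2026-08-28.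
WHY.  ED.35 (`…V6EPairNP` :330) calls this lineage's `stepL2_of_letter_schemas_residual` with binders `h31' h46' h49' hBJ' hD2L2'` at the small-cube class; at the STEP-3
re-press (form (α), dag-n06-d g12 12:09Z; class of record := print's class, node00-def-Y g22 RULING-W′) those binders read `(bg9YP …).Reg335 c35Y α₀ U →
(bg9YP …).Reg336 c35Y α₀ U → …`.  `…N06StepL2AtPinsPhysR` is the class-parametric face; THIS FILE is its instance at print's class with the premises written EXACTLY as the
re-pressed binders read (objects over `bg9Y`, premises at `bg9YP`, constant `c` free — `c := c35Y` at the record), so the ED.39 call is the ED.35 call with `c35Y` inserted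
after `H` and nothing to unify (`bg9YP_eq_bg9YR` is `rfl`; class axiom `memOfFam_regYP335`).
★★ `stepL2_of_letter_schemas_residual_P`.
HONEST FRAMING.  Instantiation bookkeeping; COUNT-NEUTRAL; nothing of [B9] asserted — Theorem 3.1 (3.42)∕(3.46)₄, (3.49), (3.117) at `U ≠ 1` and the residual letter are
DISPLAYED hypotheses; N06 NOT discharged; K1 NOT closed.  One finite 𝕋⁴ programme at fixed `ε` — NOT continuum, NOT OS, NOT the mass gap ∕ Clay.  0 `def`, 0 `sorry`.
-/

noncomputable section

namespace Summit.QuantumFields.YangMills.BalabanUVNodes.N06StepL2AtPinsPhysP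

open Literature.MathematicalPhysics.QuantumFieldTheory.Balaban1983to89
open Literature.MathematicalPhysics.QuantumFieldTheory.Balaban1983to89.Node00 (CfgY GpY GpPhysY parSymY hessY_isSymmTr isAdjTr_comp isAdjTr_of_isSymmTr)
open Literature.MathematicalPhysics.QuantumFieldTheory.Balaban1983to89.Node00.OpsYSectDCoords (DvcoKH DvscoKH RcoK TpicoK T2coK isTransposePair_DvcoKH_DvscoKH
  isTransposePair_RcoK isTransposePair_coordOpKH_trBasis)
open Literature.MathematicalPhysics.QuantumFieldTheory.Balaban1983to89.B9Thm34Ext (toB6)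
open Literature.MathematicalPhysics.QuantumFieldTheory.Balaban1983to89.B11SectG (BlockNorm HasMaj RowSum)
open Literature.MathematicalPhysics.QuantumFieldTheory.Balaban1983to89.B9SectDL2Decay (BlockBd)
open Literature.MathematicalPhysics.QuantumFieldTheory.Balaban1983to89.B9Thm37Glue (IsTransposePair isTransposePair_one)
open Literature.MathematicalPhysics.QuantumFieldTheory.Balaban1983to89.B9Thm312Whole (GeoOK)
open Literature.MathematicalPhysics.QuantumFieldTheory.Balaban1983to89.B9Thm312WholeL2 (StepL2)
open Literature.MathematicalPhysics.QuantumFieldTheory.Balaban1983to89.B9RWSums343to347Whole (Facts347)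
open Literature.MathematicalPhysics.QuantumFieldTheory.Balaban1983to89.B9RWSumsDefinitePins (PinPrims)
open Literature.MathematicalPhysics.QuantumFieldTheory.Balaban1983to89.B9RWSums347DefiniteFaces (exp261 lemma21Pack_geo9Y)
open Literature.MathematicalPhysics.QuantumFieldTheory.Balaban1983to89.B9RowSum261DefiniteFaces (rowConst261 rowConst261_nonneg rowConst261_spec_of_rowSum261)
open Literature.MathematicalPhysics.QuantumFieldTheory.Balaban1983to89.B9PinMembersKLevelV1 (MemberY geo9Y bg9Y)
open Literature.MathematicalPhysics.QuantumFieldTheory.Balaban1983to89.B9BackgroundsKLevelV1R (regYP335 regYP336 memOfFam_regYP335)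
open Literature.MathematicalPhysics.QuantumFieldTheory.Balaban1983to89.B9BackgroundsKLevelV1P (bg9YP)
open Summit.QuantumFields.YangMills.BalabanUVNodes.N06StepL2AtPinsPhysR (stepL2_of_letter_schemas_residualR)
open Literature.MathematicalPhysics.QuantumFieldTheory.Balaban1983to89.B9GeoLemma21KLevelV1 (geo9Y_len_pos geo9Y_dist_triangle geo9Y_dist_comm rowSum261_geo9Y)
open Literature.MathematicalPhysics.QuantumFieldTheory.Balaban1983to89.B9GeoNormsKLevelV1 (geo9K_dist_nonneg)
open Literature.MathematicalPhysics.QuantumFieldTheory.Balaban1983to89.B7Prop2SpecialUnitary (specialUnitaryUnits specialUnitaryUnits_le_unitaryUnits)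
open Literature.MathematicalPhysics.QuantumFieldTheory.Balaban1983to89.B9CoReadingCoords (XBK)
open Literature.MathematicalPhysics.QuantumFieldTheory.Balaban1983to89.B9CoReadingCoordsH (XHK)
open Literature.MathematicalPhysics.QuantumFieldTheory.Balaban1983to89.B9CoReadingCoordsS (XSK GcoS)
open Literature.MathematicalPhysics.QuantumFieldTheory.Balaban1983to89.B9CoReadingCoordsTranspose (TrIdx trBasis isTransposePair_GcoS_trBasis)
open Literature.MathematicalPhysics.QuantumFieldTheory.Balaban1983to89.B9Thm39ReadingCoords (cR39)
open Literature.MathematicalPhysics.QuantumFieldTheory.Balaban1983to89.Node00.OpsYSectDCoords (cR39_trBasis_pos)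
open Literature.MathematicalPhysics.QuantumFieldTheory.Balaban1983to89.B9PerturbationSplitAtLetters (TaLcoK TbLcoKH tpicoK_eq_splitL hessGradY divHessY)
open Literature.MathematicalPhysics.QuantumFieldTheory.Balaban1983to89.B9PerturbationMajorantAlgebra (Thm31GpMaj Proj349Maj CurrentMaj)
open Literature.MathematicalPhysics.QuantumFieldTheory.Balaban1983to89.B9PerturbationMajorantsAtLetters (BcoKH BdcoKH PcoK rcoK_eq)
open Literature.MathematicalPhysics.QuantumFieldTheory.Balaban1983to89.B9PerturbationMajorantsAtLettersPhys (taLcoK_phys_eq_comp tbLcoKH_phys_eq_comp)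
open Literature.MathematicalPhysics.QuantumFieldTheory.Balaban1983to89.B9PerturbationL2Algebra (Thm31GpL2Mixed)
open Literature.MathematicalPhysics.QuantumFieldTheory.Balaban1983to89.B9PerturbationL2Letters (constL2 constL2_nonneg blockBd_tpi_of_split stepL2_of_blockBd)
open Literature.MathematicalPhysics.QuantumFieldTheory.Balaban1983to89.B9PerturbationL2Delta2 (D2coK constL2Pi constL2Pi_nonneg blockBd_t2_of_residual t2coK_phys_eq_sandwich)
open Literature.MathematicalPhysics.QuantumFieldTheory.Balaban1983to89.B9Thm311AdjointPairs (GpY_isSymmTr isAdjTr_gradY_divY)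
open Literature.MathematicalPhysics.QuantumFieldTheory.Balaban1983to89.B9Thm311SymmAtRecordV4 (symm0_parSymY)
open scoped Matrix.Norms.L2Operator

variable {N : ℕ} [NeZero N]
variable {d ℓ : ℕ} {hd : 1 ≤ d + 1} {hL : Odd (ℓ + 1) ∧ 1 < ℓ + 1} {b₀ b₁ : ℝ} {Mstar : ℕ}
variable [∀ x : MemberY d ℓ hd hL b₀ b₁ Mstar, Fintype (geo9Y x).Site]

/-- ★★ **THE CERTIFICATE'S `hstepL2` AT THE STEP-3 PREMISE (PRINT'S CLASS), Δ⁽²⁾_π LETTER ON THE RAW RESIDUAL**: `stepL2_of_letter_schemas_residualR` at `R₁ := regYP335`,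
`R₂ := regYP336` (`hG := memOfFam_regYP335`), premises spelled `(bg9YP …).Reg335 c α₀ U` — the inputs `h31 h46 h49 hBJ hD2L2` in dag-n06-d's re-pressed binder form, the
pins `hTpico12 hT2co12`, numerics and the two displayed constants as in the original ⟹ above ONE threshold `StepL2 (𝔬12 x) 1 (H x) ((t2L + t2P)·(M_xα₀)) δ_T U` for every `U`
in print's class (3.36) of the member. [cite: Balaban1985BackgroundPropagators, (3.130)–(3.131) pp.421–422, (3.135) p.422, (3.137)–(3.138) p.423, (3.46) p.398, Thm 3.1 (3.42) p.397, (3.49) p.399, (3.117) p.419, (3.35)–(3.36) p.396; Balaban1984PropagatorsII, (2.54), (2.60)–(2.61) pp.233–234] -/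
theorem stepL2_of_letter_schemas_residual_P (q : PinPrims) (hq : q.OK) (H : MemberY d ℓ hd hL b₀ b₁ Mstar → Prop) (c : ℝ)
    (𝔬12 : ∀ x : MemberY d ℓ hd hL b₀ b₁ Mstar, B9Thm312Whole.Ops (geo9Y x) (bg9Y (Matrix (Fin N) (Fin N) ℂ) (specialUnitaryUnits (Fin N)) x)
      (XBK (TrIdx N) x.toKIdx) (XBK (TrIdx N) x.toKIdx) (XHK (TrIdx N) x.toKIdx) (XSK (TrIdx N) x.toKIdx))
    (Δ2 : ∀ x : MemberY d ℓ hd hL b₀ b₁ Mstar, Node00.BondOpY (Matrix (Fin N) (Fin N) ℂ) x.toKIdx)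
    (B₀ δ₀ CP δP tJ δB B₄ δ₄ r δT σS t2L θ₂ δ₂ t2P M a : ℝ) (hB₀ : 0 ≤ B₀) (hCP : 0 ≤ CP) (htJ : 0 ≤ tJ) (hB₄ : 0 ≤ B₄) (hθ₂ : 0 ≤ θ₂)
    (hσS : 0 < σS) (hM : 0 < M) (hr₀ : r ≤ δ₀) (hrP : r ≤ δP) (hrB : r ≤ δB) (hr₄ : r ≤ δ₄) (hr₂ : r ≤ δ₂) (hδT : 0 ≤ δT)
    (hδTr : δT + 3 * σS + 3 * (q.αF * ((1 - 2 * q.α) * q.δ₀)) ≤ r)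
    (ht2L : constL2 (cR39 (trBasis N))⁻¹ B₀ CP B₄
      (rowConst261 (geo9Y (d := d) (ℓ := ℓ) (hd := hd) (hL := hL) (b₀ := b₀) (b₁ := b₁) (Mstar := Mstar)) σS) ((ℓ + 1 : ℕ) : ℝ) * tJ ≤ t2L)
    (ht2P : θ₂ * constL2Pi (cR39 (trBasis N))⁻¹ B₀ CP B₄
      (rowConst261 (geo9Y (d := d) (ℓ := ℓ) (hd := hd) (hL := hL) (b₀ := b₀) (b₁ := b₁) (Mstar := Mstar)) σS) ((ℓ + 1 : ℕ) : ℝ) ≤ t2P)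
    (hTpico12 : ∀ (x : MemberY d ℓ hd hL b₀ b₁ Mstar) (U : (bg9Y (Matrix (Fin N) (Fin N) ℂ) (specialUnitaryUnits (Fin N)) x).Cfg), (𝔬12 x).Tpi U =
      TpicoK x.toKIdx (trBasis N) (bg9Y (Matrix (Fin N) (Fin N) ℂ) (specialUnitaryUnits (Fin N)) x) (fun U => U) (parSymY x.toKIdx)
        (GpPhysY x.toKIdx (parSymY x.toKIdx)) U)
    (hT2co12 : ∀ (x : MemberY d ℓ hd hL b₀ b₁ Mstar) (U : (bg9Y (Matrix (Fin N) (Fin N) ℂ) (specialUnitaryUnits (Fin N)) x).Cfg), (𝔬12 x).T2 U =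
      T2coK x.toKIdx (trBasis N) (bg9Y (Matrix (Fin N) (Fin N) ℂ) (specialUnitaryUnits (Fin N)) x) (fun U => U) (parSymY x.toKIdx)
        (GpPhysY x.toKIdx (parSymY x.toKIdx)) (Δ2 x) U)
    (h31 : ∀ x : MemberY d ℓ hd hL b₀ b₁ Mstar, M ≤ (geo9Y x).M → ∀ α₀ : ℝ, 0 < α₀ → (geo9Y x).M * α₀ ≤ a →
      ∀ U : (bg9Y (Matrix (Fin N) (Fin N) ℂ) (specialUnitaryUnits (Fin N)) x).Cfg, (bg9YP (Matrix (Fin N) (Fin N) ℂ) (specialUnitaryUnits (Fin N)) x).Reg335 c α₀ U →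
        (bg9YP (Matrix (Fin N) (Fin N) ℂ) (specialUnitaryUnits (Fin N)) x).Reg336 c α₀ U →
          Thm31GpMaj (𝔬12 x).blkW (𝔬12 x).blk
            (GcoS x.toKIdx (trBasis N) (bg9Y (Matrix (Fin N) (Fin N) ℂ) (specialUnitaryUnits (Fin N)) x) (fun U => U) (GpY x.toKIdx (parSymY x.toKIdx)) U)
            (DvcoKH x.toKIdx (trBasis N) (bg9Y (Matrix (Fin N) (Fin N) ℂ) (specialUnitaryUnits (Fin N)) x) (fun U => U) U)
            (DvscoKH x.toKIdx (trBasis N) (bg9Y (Matrix (Fin N) (Fin N) ℂ) (specialUnitaryUnits (Fin N)) x) (fun U => U) U) 1 (H x) B₀ δ₀)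
    (h46 : ∀ x : MemberY d ℓ hd hL b₀ b₁ Mstar, M ≤ (geo9Y x).M → ∀ α₀ : ℝ, 0 < α₀ → (geo9Y x).M * α₀ ≤ a →
      ∀ U : (bg9Y (Matrix (Fin N) (Fin N) ℂ) (specialUnitaryUnits (Fin N)) x).Cfg, (bg9YP (Matrix (Fin N) (Fin N) ℂ) (specialUnitaryUnits (Fin N)) x).Reg335 c α₀ U →
        (bg9YP (Matrix (Fin N) (Fin N) ℂ) (specialUnitaryUnits (Fin N)) x).Reg336 c α₀ U →
          BlockBd (g := toB6 (geo9Y x) 1 (H x)) (𝔬12 x).blk (𝔬12 x).blk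
            (DvcoKH x.toKIdx (trBasis N) (bg9Y (Matrix (Fin N) (Fin N) ℂ) (specialUnitaryUnits (Fin N)) x) (fun U => U) U ∘ₗ
              GcoS x.toKIdx (trBasis N) (bg9Y (Matrix (Fin N) (Fin N) ℂ) (specialUnitaryUnits (Fin N)) x) (fun U => U) (GpY x.toKIdx (parSymY x.toKIdx)) U ∘ₗ
              DvscoKH x.toKIdx (trBasis N) (bg9Y (Matrix (Fin N) (Fin N) ℂ) (specialUnitaryUnits (Fin N)) x) (fun U => U) U)
            (fun (y y' : (geo9Y x).Site) => B₄ * Real.exp (-(δ₄ * (geo9Y x).dist y y'))))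
    (h49 : ∀ x : MemberY d ℓ hd hL b₀ b₁ Mstar, M ≤ (geo9Y x).M → ∀ α₀ : ℝ, 0 < α₀ → (geo9Y x).M * α₀ ≤ a →
      ∀ U : (bg9Y (Matrix (Fin N) (Fin N) ℂ) (specialUnitaryUnits (Fin N)) x).Cfg, (bg9YP (Matrix (Fin N) (Fin N) ℂ) (specialUnitaryUnits (Fin N)) x).Reg335 c α₀ U →
        (bg9YP (Matrix (Fin N) (Fin N) ℂ) (specialUnitaryUnits (Fin N)) x).Reg336 c α₀ U →
          Proj349Maj (𝔬12 x).blkW (𝔬12 x).blk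
            (PcoK x.toKIdx (trBasis N) (bg9Y (Matrix (Fin N) (Fin N) ℂ) (specialUnitaryUnits (Fin N)) x) (fun U => U) (parSymY x.toKIdx)
              (GpY x.toKIdx (parSymY x.toKIdx)) U)
            (DvcoKH x.toKIdx (trBasis N) (bg9Y (Matrix (Fin N) (Fin N) ℂ) (specialUnitaryUnits (Fin N)) x) (fun U => U) U)
            (DvscoKH x.toKIdx (trBasis N) (bg9Y (Matrix (Fin N) (Fin N) ℂ) (specialUnitaryUnits (Fin N)) x) (fun U => U) U) 1 (H x) CP δP)
    (hBJ : ∀ x : MemberY d ℓ hd hL b₀ b₁ Mstar, M ≤ (geo9Y x).M → ∀ α₀ : ℝ, 0 < α₀ → (geo9Y x).M * α₀ ≤ a →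
      ∀ U : (bg9Y (Matrix (Fin N) (Fin N) ℂ) (specialUnitaryUnits (Fin N)) x).Cfg, (bg9YP (Matrix (Fin N) (Fin N) ℂ) (specialUnitaryUnits (Fin N)) x).Reg335 c α₀ U →
        (bg9YP (Matrix (Fin N) (Fin N) ℂ) (specialUnitaryUnits (Fin N)) x).Reg336 c α₀ U →
          CurrentMaj (𝔬12 x).blkW (𝔬12 x).blk
            (BcoKH x.toKIdx (trBasis N) (bg9Y (Matrix (Fin N) (Fin N) ℂ) (specialUnitaryUnits (Fin N)) x) (fun U => U) U)
            (BdcoKH x.toKIdx (trBasis N) (bg9Y (Matrix (Fin N) (Fin N) ℂ) (specialUnitaryUnits (Fin N)) x) (fun U => U) U) 1 (H x)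
            (tJ * ((geo9Y x).M * α₀)) δB)
    (hD2L2 : ∀ x : MemberY d ℓ hd hL b₀ b₁ Mstar, M ≤ (geo9Y x).M → ∀ α₀ : ℝ, 0 < α₀ → (geo9Y x).M * α₀ ≤ a →
      ∀ U : (bg9Y (Matrix (Fin N) (Fin N) ℂ) (specialUnitaryUnits (Fin N)) x).Cfg, (bg9YP (Matrix (Fin N) (Fin N) ℂ) (specialUnitaryUnits (Fin N)) x).Reg335 c α₀ U →
        (bg9YP (Matrix (Fin N) (Fin N) ℂ) (specialUnitaryUnits (Fin N)) x).Reg336 c α₀ U →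
          BlockBd (g := toB6 (geo9Y x) 1 (H x)) (𝔬12 x).blk (𝔬12 x).blk
            (D2coK x.toKIdx (trBasis N) (bg9Y (Matrix (Fin N) (Fin N) ℂ) (specialUnitaryUnits (Fin N)) x) (fun U => U) (Δ2 x) U)
            (fun (y y' : (geo9Y x).Site) => θ₂ * ((geo9Y x).M * α₀) * ((geo9Y x).len y)⁻¹ * ((geo9Y x).len y')⁻¹ *
              Real.exp (-(δ₂ * (geo9Y x).dist y y')))) :
    ∃ ML : ℝ, ∀ x : MemberY d ℓ hd hL b₀ b₁ Mstar, ML ≤ (geo9Y x).M → M ≤ (geo9Y x).M → ∀ α₀ : ℝ, 0 < α₀ → (geo9Y x).M * α₀ ≤ a →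
      ∀ U : (bg9Y (Matrix (Fin N) (Fin N) ℂ) (specialUnitaryUnits (Fin N)) x).Cfg, (bg9YP (Matrix (Fin N) (Fin N) ℂ) (specialUnitaryUnits (Fin N)) x).Reg335 c α₀ U →
        (bg9YP (Matrix (Fin N) (Fin N) ℂ) (specialUnitaryUnits (Fin N)) x).Reg336 c α₀ U →
          StepL2 (𝔬12 x) 1 (H x) ((t2L + t2P) * ((geo9Y x).M * α₀)) δT U :=
  stepL2_of_letter_schemas_residualR q hq H (regYP335 (Matrix (Fin N) (Fin N) ℂ) (specialUnitaryUnits (Fin N)))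
    (regYP336 (Matrix (Fin N) (Fin N) ℂ) (specialUnitaryUnits (Fin N))) memOfFam_regYP335 c 𝔬12 Δ2 B₀ δ₀ CP δP tJ δB B₄ δ₄ r δT σS t2L θ₂ δ₂ t2P M a hB₀ hCP htJ hB₄ hθ₂
    hσS hM hr₀ hrP hrB hr₄ hr₂ hδT hδTr ht2L ht2P hTpico12 hT2co12 h31 h46 h49 hBJ hD2L2

end Summit.QuantumFields.YangMills.BalabanUVNodes.N06StepL2AtPinsPhysP

end
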